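import Literature.Barriers.CriticalPhenomena.WeaklySAWCouplingFlowCutoff
import HarnessLib

/-!
# The flow `ḡ_{j+1} = ḡ_j - β_jḡ_j²` is stable under `ℓ¹`-small perturbations of `β`, with
# RELATIVE error `O(ḡ_j)`: `|ḡ_j(β) - ḡ_j(β')| ≤ 4(Σ_{l<j}|β_l - β'_l|)·ḡ_j(β)ḡ_j(β')`

Continuation of `WeaklySAWCouplingFlow.lean` (`gbar`, `GbarHyp`) and
`WeaklySAWCouplingFlowComparison.lean` (comparison in the initial condition, [BBS-rg-flow, Lemma
2.1(iv)]). BBS 2015 (Bauerschmidt–Brydges–Slade, CMP 337 (2015)), Lemma 7.3.1(i) of the held text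
(§7.3.1, "Preliminaries: the sequence `g̃` and norms") compares the flows of `ḡ` driven by the
massless and by the massive coefficients, `ḡ_j(0,g₀)` and `ḡ_j(m²,g₀)`, and asserts
`g̃_j(m²,g₀) = ḡ_j(m²,g₀) + O(ḡ_j²(m²,g₀))` uniformly — a relative error `O(ḡ_j)`, much better than
the `O(1)` a naive Gronwall argument gives. The printed proof differentiates in `m²`
("`ḡ̇_j = -Σ_{l<j}∏(1 - 2β_jḡ_j)β̇_lḡ_l² = O(ḡ_j²L^{2j})`", then integrates); the present file
isolates the elementary mechanism behind it as a statement about two ABSTRACT coefficient sequences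
`β, β' ≥ 0` (both under `GbarHyp` with the same `B`, `g₀`): if `Σ_{l<J}|β_l - β'_l| ≤ E` and
`16Eg₀ ≤ 1`, then for all `j ≤ J`

  `|ḡ_j(β) - ḡ_j(β')| ≤ 4E·ḡ_j(β)ḡ_j(β')` (hence `≤ 6E·ḡ_j(β')²`).

The proof is the difference recursion `d_{j+1} = d_j(1 - β_j(a_j + b_j)) - (β_j - β'_j)b_j²`
(`a = ḡ(β)`, `b = ḡ(β')`), the comparison `1 - β_j(a_j + b_j) ≤ (a_{j+1}b_{j+1})/(a_jb_j) + |β_j - β'_j|b_j`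
of its propagator with the product of the two flows, and a bootstrap on the comparability
`b_j ≤ 2a_j`.

## Main results

* `gbar_sub_gbar_beta_succ` — the difference recursion;
* `GbarHyp.abs_gbar_sub_gbar_beta_le` — **`|ḡ_j(β) - ḡ_j(β')| ≤ 4E·ḡ_j(β)ḡ_j(β')` for `j ≤ J`**;
* `GbarHyp.abs_gbar_sub_gbar_beta_le_sq` — `≤ 6E·ḡ_j(β')²`, and the comparability
  `¾ ≤ ḡ_j(β)/ḡ_j(β') ≤ 4/3` (`GbarHyp.gbar_div_gbar_beta_mem`).
-/

noncomputable section

open Finset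
open scoped BigOperators

namespace Literature.Barriers.CriticalPhenomena

namespace CTWSAW

/-- **The difference recursion for two coefficient sequences**:
`ḡ_{j+1}(β) - ḡ_{j+1}(β') = (ḡ_j(β) - ḡ_j(β'))(1 - β_j(ḡ_j(β) + ḡ_j(β'))) - (β_j - β'_j)ḡ_j(β')²`.
[cite: BauerschmidtBrydgesSlade2015LogCorr, §7.3.1, Lemma 7.3.1(i) (proof: "ḡ̇_{j+1} = ḡ̇_j(1 - 2β_jḡ_j) - β̇_jḡ_j²", here in finite-difference form)] -/
theorem gbar_sub_gbar_beta_succ (β β' : ℕ → ℝ) (g₀ : ℝ) (j : ℕ) :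
    gbar β g₀ (j + 1) - gbar β' g₀ (j + 1) =
      (gbar β g₀ j - gbar β' g₀ j) * (1 - β j * (gbar β g₀ j + gbar β' g₀ j)) -
        (β j - β' j) * gbar β' g₀ j ^ 2 := by
  rw [gbar_succ, gbar_succ]; ring

namespace GbarHyp

variable {β β' : ℕ → ℝ} {B g₀ : ℝ} (h : GbarHyp β B g₀) (h' : GbarHyp β' B g₀)
include h h'

/-- The propagator of the difference recursion is dominated by the product of the two flows:
`0 ≤ 1 - β_j(a_j + b_j) ≤ (a_{j+1}b_{j+1})/(a_jb_j) + |β_j - β'_j|b_j` with `a = ḡ(β)`, `b = ḡ(β')`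
(indeed `(1 - β_ja_j)(1 - β'_jb_j) - (1 - β_j(a_j+b_j)) = (β_j - β'_j)b_j·(-1)… + β_jβ'_ja_jb_j`).
[cite: BauerschmidtBrydgesSlade2015LogCorr, §7.3.1, Lemma 7.3.1(i) (proof: ∏(1-2β_kḡ_k) = (1+O(g₀))(ḡ_j/ḡ_l)², via [BBS-rg-flow, Lemma 2.1(iii)])] -/
theorem propagator_le (j : ℕ) :
    0 ≤ 1 - β j * (gbar β g₀ j + gbar β' g₀ j) ∧
      1 - β j * (gbar β g₀ j + gbar β' g₀ j) ≤
        (1 - β j * gbar β g₀ j) * (1 - β' j * gbar β' g₀ j) + |β j - β' j| * gbar β' g₀ j := by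
  have ha := h.beta_mul_gbar_le j
  have hb0 := (h'.gbar_pos j).le
  have hbg := h'.gbar_le_init j
  have hβB := h.beta_le j
  have hβ0 := h.beta_nonneg j
  have hβ'0 := h'.beta_nonneg j
  have hsm := h.small
  have ha0 := (h.gbar_pos j).le
  constructor
  · have : β j * gbar β' g₀ j ≤ 1 / 4 :=
      calc β j * gbar β' g₀ j ≤ B * g₀ := mul_le_mul hβB hbg hb0 h.B_nonneg
        _ ≤ 1 / 4 := hsm
    nlinarith
  · have e : (1 - β j * gbar β g₀ j) * (1 - β' j * gbar β' g₀ j) - (1 - β j * (gbar β g₀ j + gbar β' g₀ j))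
        = (β j - β' j) * gbar β' g₀ j + β j * β' j * gbar β g₀ j * gbar β' g₀ j := by ring
    have h1 : -(|β j - β' j| * gbar β' g₀ j) ≤ (β j - β' j) * gbar β' g₀ j := by
      have := neg_abs_le (β j - β' j)
      nlinarith
    have h2 : 0 ≤ β j * β' j * gbar β g₀ j * gbar β' g₀ j := by positivity
    linarith

/-- **`ℓ¹`-stability of the `ḡ`-flow with relative error `O(ḡ_j)`**: for `β, β' ≥ 0` (both under
`GbarHyp` with `B`, `g₀`), if `Σ_{l<J}|β_l - β'_l| ≤ E` and `16Eg₀ ≤ 1` then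
`|ḡ_j(β) - ḡ_j(β')| ≤ 4E·ḡ_j(β)ḡ_j(β')` and `ḡ_j(β') ≤ 2ḡ_j(β)` for all `j ≤ J`.
[cite: BauerschmidtBrydgesSlade2015LogCorr, §7.3.1, Lemma 7.3.1(i) ("g̃_j(m²,g₀) = ḡ_j(m²,g₀) + O(ḡ_j²(m²,g₀))", whose proof integrates |ḡ_j(0) - ḡ_j(m²)| ≤ O(ḡ_j²))] -/
theorem abs_gbar_sub_gbar_beta_le_and {E : ℝ} (hE : 0 ≤ E) {J : ℕ}
    (hsum : ∑ l ∈ Finset.range J, |β l - β' l| ≤ E) (hsmall : 16 * E * g₀ ≤ 1) :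
    ∀ j ≤ J, |gbar β g₀ j - gbar β' g₀ j| ≤ 4 * E * (gbar β g₀ j * gbar β' g₀ j) ∧
      gbar β' g₀ j ≤ 2 * gbar β g₀ j := by
  have hg := h.pos
  -- notation
  set a : ℕ → ℝ := gbar β g₀ with ha
  set b : ℕ → ℝ := gbar β' g₀ with hb
  set δ : ℕ → ℝ := fun l => |β l - β' l| with hδ
  have hδ0 : ∀ l, 0 ≤ δ l := fun l => abs_nonneg _
  -- partial sums of `δ` below `J` are `≤ E`
  have hS : ∀ j ≤ J, ∑ l ∈ Finset.range j, δ l ≤ E := fun j hj =>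
    (Finset.sum_le_sum_of_subset_of_nonneg (Finset.range_mono hj) fun l _ _ => hδ0 l).trans hsum
  -- the majorant `T_j = ∏_{l<j}(1 + (16/9)g₀δ_l) · (32/9)Σ_{l<j}δ_l ≤ 4E`
  set T : ℕ → ℝ := fun j => (∏ l ∈ Finset.range j, (1 + 16 / 9 * g₀ * δ l)) *
    (32 / 9 * ∑ l ∈ Finset.range j, δ l) with hT
  have hT0 : ∀ j, 0 ≤ T j := fun j => by
    rw [hT]
    exact mul_nonneg (Finset.prod_nonneg fun l _ => by have := hδ0 l; positivity)
      (mul_nonneg (by norm_num) (Finset.sum_nonneg fun l _ => hδ0 l))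
  have hTle : ∀ j ≤ J, T j ≤ 4 * E := fun j hj => by
    have hs := hS j hj
    have hx : ∑ l ∈ Finset.range j, 16 / 9 * g₀ * δ l ≤ 1 / 9 := by
      rw [← Finset.mul_sum]
      calc 16 / 9 * g₀ * ∑ l ∈ Finset.range j, δ l ≤ 16 / 9 * g₀ * E :=
            mul_le_mul_of_nonneg_left hs (by positivity)
        _ = (16 * E * g₀) / 9 := by ring
        _ ≤ 1 / 9 := by linarith
    have hprod := prod_one_add_le_inv_one_sub_sum (Finset.range j) (fun l => 16 / 9 * g₀ * δ l)
      (fun l _ => by have := hδ0 l; positivity) (by linarith)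
    have hinv : (1 - ∑ l ∈ Finset.range j, 16 / 9 * g₀ * δ l)⁻¹ ≤ 9 / 8 := by
      rw [inv_le_comm₀ (by linarith) (by norm_num)]
      linarith
    rw [hT]
    calc (∏ l ∈ Finset.range j, (1 + 16 / 9 * g₀ * δ l)) * (32 / 9 * ∑ l ∈ Finset.range j, δ l)
        ≤ (9 / 8) * (32 / 9 * E) :=
          mul_le_mul (hprod.trans hinv) (mul_le_mul_of_nonneg_left hs (by norm_num))
            (mul_nonneg (by norm_num) (Finset.sum_nonneg fun l _ => hδ0 l)) (by norm_num)
      _ = 4 * E := by ring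
  -- `T_{j+1} ≥ (1 + (16/9)g₀δ_j)T_j + (32/9)δ_j`
  have hTsucc : ∀ j, (1 + 16 / 9 * g₀ * δ j) * T j + 32 / 9 * δ j ≤ T (j + 1) := fun j => by
    have hP1 : 1 ≤ ∏ l ∈ Finset.range j, (1 + 16 / 9 * g₀ * δ l) := by
      calc (1 : ℝ) = ∏ _l ∈ Finset.range j, (1 : ℝ) := by simp
        _ ≤ _ := Finset.prod_le_prod (fun l _ => zero_le_one) fun l _ => by
            have := hδ0 l; nlinarith [hg.le]
    have hx0 : 0 ≤ 16 / 9 * g₀ * δ j := by have := hδ0 j; positivity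
    simp only [hT]
    rw [Finset.prod_range_succ, Finset.sum_range_succ]
    have hsum0 : 0 ≤ ∑ l ∈ Finset.range j, δ l := Finset.sum_nonneg fun l _ => hδ0 l
    have hdj := hδ0 j
    nlinarith [mul_nonneg hx0 hdj, mul_le_mul_of_nonneg_right hP1 (mul_nonneg hx0 hdj),
      mul_le_mul_of_nonneg_right hP1 hdj]
  -- the induction, with the comparability `b_j ≤ 2a_j`
  have key : ∀ j, j ≤ J → |a j - b j| ≤ T j * (a j * b j) ∧ b j ≤ 2 * a j := by
    intro j
    induction j with
    | zero =>
      intro _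
      simp [ha, hb, hT]
      linarith
    | succ j ih =>
      intro hj1
      obtain ⟨ihd, ihq⟩ := ih (Nat.le_of_succ_le hj1)
      have haj := h.gbar_pos j; have hbj := h'.gbar_pos j
      have haj1 := h.gbar_pos (j + 1); have hbj1 := h'.gbar_pos (j + 1)
      have hag := h.gbar_le_init j
      have hbg := h'.gbar_le_init j
      obtain ⟨hF0, hFle⟩ := propagator_le h h' j
      have hGa := h.one_sub_ge j     -- `3/4 ≤ 1 - β_ja_j`
      have hGb := h'.one_sub_ge j
      -- the step: `|d_{j+1}| ≤ |d_j|F_j + δ_jb_j²`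
      have hstep : |a (j + 1) - b (j + 1)| ≤
          |a j - b j| * (1 - β j * (a j + b j)) + δ j * b j ^ 2 := by
        rw [ha, hb, gbar_sub_gbar_beta_succ]
        refine (abs_sub _ _).trans ?_
        rw [abs_mul, abs_of_nonneg hF0, abs_mul, abs_of_nonneg (sq_nonneg (gbar β' g₀ j))]
      -- products of the two flows
      have hprodab : a (j + 1) * b (j + 1) = a j * b j * ((1 - β j * a j) * (1 - β' j * b j)) := by
        rw [ha, hb, gbar_succ' β g₀ j, gbar_succ' β' g₀ j]; ring
      have hab9 : 9 / 16 * (a j * b j) ≤ a (j + 1) * b (j + 1) := by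
        rw [hprodab]
        have : (9 : ℝ) / 16 ≤ (1 - β j * a j) * (1 - β' j * b j) := by nlinarith
        nlinarith [mul_pos haj hbj]
      -- the bound at `j+1` with the constant `T_{j+1}`
      have hd1 : |a (j + 1) - b (j + 1)| ≤ T (j + 1) * (a (j + 1) * b (j + 1)) := by
        have hTj := hT0 j
        have hdj := hδ0 j
        have h1 : |a j - b j| * (1 - β j * (a j + b j)) ≤
            T j * (a j * b j) * ((1 - β j * a j) * (1 - β' j * b j)) + T j * (a j * b j) * (δ j * b j) := by
          calc |a j - b j| * (1 - β j * (a j + b j))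
              ≤ T j * (a j * b j) * ((1 - β j * a j) * (1 - β' j * b j) + δ j * b j) :=
                mul_le_mul ihd hFle hF0 (by positivity)
            _ = _ := by ring
        have h2 : δ j * b j ^ 2 ≤ δ j * (2 * (a j * b j)) := by
          refine mul_le_mul_of_nonneg_left ?_ hdj
          nlinarith
        calc |a (j + 1) - b (j + 1)|
            ≤ T j * (a j * b j) * ((1 - β j * a j) * (1 - β' j * b j)) +
                T j * (a j * b j) * (δ j * b j) + δ j * (2 * (a j * b j)) := by linarith [hstep]
          _ = T j * (a (j + 1) * b (j + 1)) + δ j * (a j * b j) * (T j * b j + 2) := by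
              rw [hprodab]; ring
          _ ≤ T j * (a (j + 1) * b (j + 1)) + δ j * (a j * b j) * (T j * g₀ + 2) := by
              gcongr
          _ ≤ T j * (a (j + 1) * b (j + 1)) +
                (16 / 9 * g₀ * δ j * T j + 32 / 9 * δ j) * (a (j + 1) * b (j + 1)) := by
              have e : δ j * (a j * b j) * (T j * g₀ + 2) =
                  (16 / 9 * g₀ * δ j * T j + 32 / 9 * δ j) * (9 / 16 * (a j * b j)) := by ring
              rw [e]
              gcongr
          _ = ((1 + 16 / 9 * g₀ * δ j) * T j + 32 / 9 * δ j) * (a (j + 1) * b (j + 1)) := by ring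
          _ ≤ T (j + 1) * (a (j + 1) * b (j + 1)) :=
              mul_le_mul_of_nonneg_right (hTsucc j) (by positivity)
      refine ⟨hd1, ?_⟩
      -- comparability at `j+1`: `|d| ≤ 4E·g₀·b ≤ b/4`
      have hT1 := hTle (j + 1) hj1
      have hag1 := h.gbar_le_init (j + 1)
      have : |a (j + 1) - b (j + 1)| ≤ 1 / 4 * b (j + 1) :=
        calc |a (j + 1) - b (j + 1)| ≤ T (j + 1) * (a (j + 1) * b (j + 1)) := hd1
          _ ≤ 4 * E * (g₀ * b (j + 1)) := mul_le_mul hT1 (mul_le_mul_of_nonneg_right hag1 hbj1.le)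
              (by positivity) (by positivity)
          _ = (16 * E * g₀) / 4 * b (j + 1) := by ring
          _ ≤ 1 / 4 * b (j + 1) := mul_le_mul_of_nonneg_right (by linarith) hbj1.le
      linarith [neg_abs_le (a (j + 1) - b (j + 1))]
  intro j hj
  obtain ⟨h1, h2⟩ := key j hj
  exact ⟨h1.trans (mul_le_mul_of_nonneg_right (hTle j hj)
    (mul_nonneg (h.gbar_pos j).le (h'.gbar_pos j).le)), h2⟩

/-- **`|ḡ_j(β) - ḡ_j(β')| ≤ 4E·ḡ_j(β)ḡ_j(β')` for `j ≤ J`** (the relative error is `O(ḡ_j)`).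
[cite: BauerschmidtBrydgesSlade2015LogCorr, §7.3.1, Lemma 7.3.1(i)] -/
theorem abs_gbar_sub_gbar_beta_le {E : ℝ} (hE : 0 ≤ E) {J : ℕ}
    (hsum : ∑ l ∈ Finset.range J, |β l - β' l| ≤ E) (hsmall : 16 * E * g₀ ≤ 1) {j : ℕ} (hj : j ≤ J) :
    |gbar β g₀ j - gbar β' g₀ j| ≤ 4 * E * (gbar β g₀ j * gbar β' g₀ j) :=
  (h.abs_gbar_sub_gbar_beta_le_and h' hE hsum hsmall j hj).1

/-- The two flows are comparable: `¾ḡ_j(β') ≤ ḡ_j(β) ≤ (4/3)ḡ_j(β')` for `j ≤ J`.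
[cite: BauerschmidtBrydgesSlade2015LogCorr, §7.3.1, Lemma 7.3.1(i) ("ḡ_j(m²) ≤ (1+O(ḡ₀))ḡ_j(0)")] -/
theorem gbar_div_gbar_beta_mem {E : ℝ} (hE : 0 ≤ E) {J : ℕ}
    (hsum : ∑ l ∈ Finset.range J, |β l - β' l| ≤ E) (hsmall : 16 * E * g₀ ≤ 1) {j : ℕ} (hj : j ≤ J) :
    3 / 4 * gbar β' g₀ j ≤ gbar β g₀ j ∧ gbar β g₀ j ≤ 4 / 3 * gbar β' g₀ j := by
  have hd := h.abs_gbar_sub_gbar_beta_le h' hE hsum hsmall hj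
  have ha := h.gbar_pos j; have hb := h'.gbar_pos j
  have hag := h.gbar_le_init j; have hbg := h'.gbar_le_init j
  have h1 : |gbar β g₀ j - gbar β' g₀ j| ≤ 1 / 4 * gbar β' g₀ j :=
    calc |gbar β g₀ j - gbar β' g₀ j| ≤ 4 * E * (g₀ * gbar β' g₀ j) :=
          hd.trans (mul_le_mul_of_nonneg_left (mul_le_mul_of_nonneg_right hag hb.le) (by positivity))
      _ = (16 * E * g₀) / 4 * gbar β' g₀ j := by ring
      _ ≤ 1 / 4 * gbar β' g₀ j := mul_le_mul_of_nonneg_right (by linarith) hb.le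
  have h2 : |gbar β g₀ j - gbar β' g₀ j| ≤ 1 / 4 * gbar β g₀ j :=
    calc |gbar β g₀ j - gbar β' g₀ j| ≤ 4 * E * (gbar β g₀ j * g₀) :=
          hd.trans (mul_le_mul_of_nonneg_left (mul_le_mul_of_nonneg_left hbg ha.le) (by positivity))
      _ = (16 * E * g₀) / 4 * gbar β g₀ j := by ring
      _ ≤ 1 / 4 * gbar β g₀ j := mul_le_mul_of_nonneg_right (by linarith) ha.le
  constructor
  · linarith [neg_abs_le (gbar β g₀ j - gbar β' g₀ j)]
  · linarith [le_abs_self (gbar β g₀ j - gbar β' g₀ j)]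

/-- **`|ḡ_j(β) - ḡ_j(β')| ≤ 6E·ḡ_j(β')²` for `j ≤ J`** — the form "`= ḡ_j + O(ḡ_j²)`".
[cite: BauerschmidtBrydgesSlade2015LogCorr, §7.3.1, Lemma 7.3.1(i)] -/
theorem abs_gbar_sub_gbar_beta_le_sq {E : ℝ} (hE : 0 ≤ E) {J : ℕ}
    (hsum : ∑ l ∈ Finset.range J, |β l - β' l| ≤ E) (hsmall : 16 * E * g₀ ≤ 1) {j : ℕ} (hj : j ≤ J) :
    |gbar β g₀ j - gbar β' g₀ j| ≤ 6 * E * gbar β' g₀ j ^ 2 := by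
  have hd := h.abs_gbar_sub_gbar_beta_le h' hE hsum hsmall hj
  obtain ⟨-, hup⟩ := h.gbar_div_gbar_beta_mem h' hE hsum hsmall hj
  have hb := (h'.gbar_pos j).le
  calc |gbar β g₀ j - gbar β' g₀ j| ≤ 4 * E * (gbar β g₀ j * gbar β' g₀ j) := hd
    _ ≤ 4 * E * (4 / 3 * gbar β' g₀ j * gbar β' g₀ j) := by gcongr
    _ = 16 / 3 * E * gbar β' g₀ j ^ 2 := by ring
    _ ≤ 6 * E * gbar β' g₀ j ^ 2 := by nlinarith [mul_nonneg hE (sq_nonneg (gbar β' g₀ j))]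

end GbarHyp

end CTWSAW

end Literature.Barriers.CriticalPhenomena
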